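import Summits.BirchSwinnertonDyer.BirchSwinnertonDyer.Theorems.BiquadraticEisensteinDescentManinDatumSupercuspidalCMInertSevenDivisionResolventIsometry
import HarnessLib

set_option linter.dupNamespace false -- `Summit.BirchSwinnertonDyer.BirchSwinnertonDyer.Theorems.…` (summit = sub, D-0017)
set_option autoImplicit false

/-!
# Crux `ManinDatumSupercuspidalCMInert` (stmt-BirchSwinnertonDyer-20111, BED r605), CM side of H₇ — step (d) of memo PLAIN-ODD-57 DONE:
# the RESOLVENT BOUND `RES₇(k)` — `v(Σ_{c ∈ (ℤ[i]/7)ˣ} (c/7)₄^k · X_c⁻ⁿ)⁴ ≤ v(7)^{4−k}` for `k ∈ {1,2,3}`, every `n` and EVERY valuation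
# `v` of `ℂ` with `v 7 < 1` — the hypothesis `hRES` of bed-w2 g10's `…StubS7OfResolventBound.stub_S7_of_resolventBound`

Route `BiquadraticEisensteinDescent` (cell `pub/bsd-wall`, width seat `bsd-wall-cm-bed-w4` g11, RESOLVENT/GALOIS LANE; `--supports`
stmt-BirchSwinnertonDyer-20111, helper). THEOREMS ONLY (no definition, no named fact, no `sorry`); BSD is not proved by any of this.

Assembly of the lane (memo `Cruxes/ManinDatumSupercuspidalCMInert/PLAIN-ODD-57-w4g10.md` §3(c)–(e), design note `MODEL-ASSEMBLY-LANES-w2g10.md`,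
X-FORMAL route): in the `7`-division field `K₇ = ℚ(i)(X_c, Y_c : c) ⊂ ℂ` (`…SevenDivisionGalois/GaloisCount`: finite Galois of degree `48`,
`Gal ≅ (ℤ[i]/7)ˣ` via `σ_u(P_c) = P_{uc}`), with the valuation `v|_{K₇}`, the uniformiser `t_1 = X_1/Y_1` (`v(t_1)⁴⁸ = v 7`, bed-w4 g10) and
the power basis `1, t_1, …, t_1⁴⁷` (`…SevenDivisionResolventIsometry`: `Gal` acts by isometries, trivially on the residue ring, the value group
is `v(t_1)^ℤ`, the tame character `θ(σ_u) = t_u/t_1 ≡ u` has exact order `48`), and the character `χ(σ_u) := (u/7)₄^{−k} ≡ θ(σ_u)^{48−12k}`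
(`…SevenDivisionResolventArithmetic`), bed-w4 g10's ★ `…TameResolvent.resolvent_valuation_le` (`e = 48`, `j = 48 − 12k`, `y = X_1⁻ⁿ`) gives
`v(Σ_σ χ(σ)⁻¹ σ(X_1⁻ⁿ)) = v(Σ_u (u/7)₄^k X_u⁻ⁿ) ≤ v(t_1)^{48−12k}`, i.e. `v(R_n)⁴ ≤ v(7)^{4−k}`:

* ★★ `resolventBound_of_labels` — `RES₇(k)` for any labelling `c : (ℤ/7)² → ℤ[i]` of the classes modulo `7`;
* ★★★ `resolventBound_seven` — **the hypothesis `hRES` of `stub_S7_of_resolventBound` VERBATIM** (labelling `b ↦ conj(rep 7 b 0)`, weight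
  `conj((rep 7 b 0/7)₄)^k`). The closure of the registered stub `stub_S7` by name is left to the closer of record (bed-w2 g10, p640345);
  the crux also needs `stub_S5`; Manin's conjecture / BSD are NOT proved by this.

References: [Serre1979] Ch. IV §2 Prop. 7, Ch. I §6; [CasselsFrohlich1967] Ch. I §5–§6; [SilvermanATAEC1994] II.5; [IrelandRosen1982] Ch. 9 §8.
-/

noncomputable section

open scoped ComplexConjugate
open Complex PeriodPair Polynomial
open scoped PeriodPair IntermediateField BigOperators
open Literature.NumberTheory.EllipticCurves Literature.NumberTheory.EllipticCurves.GaussianLattice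
open Literature.NumberTheory.LFunctions.GaussianTheta
open Literature.NumberTheory.QuadraticFields.GaussianQuarticSymbol

namespace Summit.BirchSwinnertonDyer.BirchSwinnertonDyer.Theorems.BiquadraticEisensteinDescentManinDatumSupercuspidalCMInertSevenDivisionResolventBound

open Summit.BirchSwinnertonDyer.BirchSwinnertonDyer.Theorems.BiquadraticEisensteinDescentManinDatumSupercuspidalCMInertTameResolvent
open Summit.BirchSwinnertonDyer.BirchSwinnertonDyer.Theorems.BiquadraticEisensteinDescentManinDatumSupercuspidalCMInertSevenDivisionPoints
open Summit.BirchSwinnertonDyer.BirchSwinnertonDyer.Theorems.BiquadraticEisensteinDescentManinDatumSupercuspidalCMInertSevenDivisionField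
open Summit.BirchSwinnertonDyer.BirchSwinnertonDyer.Theorems.BiquadraticEisensteinDescentManinDatumSupercuspidalCMInertSevenDivisionGalois
open Summit.BirchSwinnertonDyer.BirchSwinnertonDyer.Theorems.BiquadraticEisensteinDescentManinDatumSupercuspidalCMInertSevenDivisionGaloisCount
open Summit.BirchSwinnertonDyer.BirchSwinnertonDyer.Theorems.BiquadraticEisensteinDescentManinDatumSupercuspidalCMInertSevenDivisionResolventArithmetic
open Summit.BirchSwinnertonDyer.BirchSwinnertonDyer.Theorems.BiquadraticEisensteinDescentManinDatumSupercuspidalCMInertSevenDivisionResolventIsometry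
open Summit.BirchSwinnertonDyer.BirchSwinnertonDyer.Theorems.BiquadraticEisensteinDescentManinDatumSupercuspidalCMInertTorsionSumRational
  (cls_eq_cls_iff)

section Resolvent

/-- ★★ **The resolvent bound for any labelling of `ℤ[i]/7`.** Let `c : (ℤ/7)² → ℤ[i]` hit every class modulo `7` once (`7 ∣ c b ↔ b = 0`,
`c b ≡ c b′ ⇒ b = b′`). Then for `1 ≤ k ≤ 3`, every `n` and every valuation `v` of `ℂ` with `v 7 < 1`:
`v(Σ_b (c_b/7)₄^k · X_{c_b}⁻ⁿ)⁴ ≤ v(7)^{4−k}` — the sum is the Lagrange resolvent `Σ_σ χ(σ)⁻¹ σ(X_1⁻ⁿ)` of the integral `X_1⁻ⁿ` for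
`χ(σ_u) = (u/7)₄^{−k} ≡ θ(σ_u)^{48−12k}` in the totally ramified layer `K₇/ℚ(i)` at `v`, and bed-w4 g10's `resolvent_valuation_le` applies with
`e = 48`, `j = 48 − 12k`. [cite: Serre1979, Ch. IV §2 Prop. 7] [cite: CasselsFrohlich1967, Ch. I §5–§6] -/
theorem resolventBound_of_labels {k : ℕ} (hk1 : 1 ≤ k) (hk3 : k ≤ 3) (n : ℕ)
    (c : ZMod 7 × ZMod 7 → GaussianInt) (hc0 : ∀ b, (7 : GaussianInt) ∣ c b ↔ b = 0)
    (hcinj : ∀ b b', (7 : GaussianInt) ∣ c b - c b' → b = b')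
    {Γ₀ : Type*} [LinearOrderedCommGroupWithZero Γ₀] (v : Valuation ℂ Γ₀) (h7 : v 7 < 1) :
    v (∑ b : ZMod 7 × ZMod 7, ((quarticCharMod 7 (c b) : GaussianInt) : ℂ) ^ k *
      ((℘[ofUpperHalfPlane UpperHalfPlane.I] (((c b : GaussianInt) : ℂ) / 7) / ((Real.Gamma (1 / 4) ^ 2 / (2 * Real.sqrt (2 * Real.pi)) : ℝ) : ℂ) ^ 2))⁻¹ ^ n) ^ 4 ≤ v 7 ^ (4 - k) := by
  classical
  haveI := finiteDimensional_adjoin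
  obtain ⟨hcard, -, -⟩ := card_algEquiv v h7
  -- the multipliers `u_σ`
  choose u hu husp using fun σ : (IntermediateField.adjoin ℚ⟮I⟯ {x : ℂ | ∃ c : GaussianInt, ¬ (7 : GaussianInt) ∣ c ∧
        (x = ℘[ofUpperHalfPlane UpperHalfPlane.I] (((c : GaussianInt) : ℂ) / 7) / ((Real.Gamma (1 / 4) ^ 2 / (2 * Real.sqrt (2 * Real.pi)) : ℝ) : ℂ) ^ 2 ∨
         x = ℘'[ofUpperHalfPlane UpperHalfPlane.I] (((c : GaussianInt) : ℂ) / 7) / (2 * ((Real.Gamma (1 / 4) ^ 2 / (2 * Real.sqrt (2 * Real.pi)) : ℝ) : ℂ) ^ 3))}) ≃ₐ[ℚ⟮I⟯]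
             (IntermediateField.adjoin ℚ⟮I⟯ {x : ℂ | ∃ c : GaussianInt, ¬ (7 : GaussianInt) ∣ c ∧
        (x = ℘[ofUpperHalfPlane UpperHalfPlane.I] (((c : GaussianInt) : ℂ) / 7) / ((Real.Gamma (1 / 4) ^ 2 / (2 * Real.sqrt (2 * Real.pi)) : ℝ) : ℂ) ^ 2 ∨
         x = ℘'[ofUpperHalfPlane UpperHalfPlane.I] (((c : GaussianInt) : ℂ) / 7) / (2 * ((Real.Gamma (1 / 4) ^ 2 / (2 * Real.sqrt (2 * Real.pi)) : ℝ) : ℂ) ^ 3))}) ↦ exists_mul_of_algEquiv σ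
  have h1 : ¬ (7 : GaussianInt) ∣ 1 := not_seven_dvd_one
  have huspX : ∀ σ : (IntermediateField.adjoin ℚ⟮I⟯ {x : ℂ | ∃ c : GaussianInt, ¬ (7 : GaussianInt) ∣ c ∧
        (x = ℘[ofUpperHalfPlane UpperHalfPlane.I] (((c : GaussianInt) : ℂ) / 7) / ((Real.Gamma (1 / 4) ^ 2 / (2 * Real.sqrt (2 * Real.pi)) : ℝ) : ℂ) ^ 2 ∨
         x = ℘'[ofUpperHalfPlane UpperHalfPlane.I] (((c : GaussianInt) : ℂ) / 7) / (2 * ((Real.Gamma (1 / 4) ^ 2 / (2 * Real.sqrt (2 * Real.pi)) : ℝ) : ℂ) ^ 3))}) ≃ₐ[ℚ⟮I⟯]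
             (IntermediateField.adjoin ℚ⟮I⟯ {x : ℂ | ∃ c : GaussianInt, ¬ (7 : GaussianInt) ∣ c ∧
        (x = ℘[ofUpperHalfPlane UpperHalfPlane.I] (((c : GaussianInt) : ℂ) / 7) / ((Real.Gamma (1 / 4) ^ 2 / (2 * Real.sqrt (2 * Real.pi)) : ℝ) : ℂ) ^ 2 ∨
         x = ℘'[ofUpperHalfPlane UpperHalfPlane.I] (((c : GaussianInt) : ℂ) / 7) / (2 * ((Real.Gamma (1 / 4) ^ 2 / (2 * Real.sqrt (2 * Real.pi)) : ℝ) : ℂ) ^ 3))}),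
             ((σ ⟨_, X_mem_adjoin h1⟩ : (IntermediateField.adjoin ℚ⟮I⟯ {x : ℂ | ∃ c : GaussianInt, ¬ (7 : GaussianInt) ∣ c ∧
        (x = ℘[ofUpperHalfPlane UpperHalfPlane.I] (((c : GaussianInt) : ℂ) / 7) / ((Real.Gamma (1 / 4) ^ 2 / (2 * Real.sqrt (2 * Real.pi)) : ℝ) : ℂ) ^ 2 ∨
         x = ℘'[ofUpperHalfPlane UpperHalfPlane.I] (((c : GaussianInt) : ℂ) / 7) / (2 * ((Real.Gamma (1 / 4) ^ 2 / (2 * Real.sqrt (2 * Real.pi)) : ℝ) : ℂ) ^ 3))})) : ℂ) =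
             (℘[ofUpperHalfPlane UpperHalfPlane.I] (((u σ : GaussianInt) : ℂ) / 7) / ((Real.Gamma (1 / 4) ^ 2 / (2 * Real.sqrt (2 * Real.pi)) : ℝ) : ℂ) ^ 2) := fun σ ↦ by
    have h := (husp σ 1 h1).1; rwa [mul_one] at h
  have huspY : ∀ σ : (IntermediateField.adjoin ℚ⟮I⟯ {x : ℂ | ∃ c : GaussianInt, ¬ (7 : GaussianInt) ∣ c ∧
        (x = ℘[ofUpperHalfPlane UpperHalfPlane.I] (((c : GaussianInt) : ℂ) / 7) / ((Real.Gamma (1 / 4) ^ 2 / (2 * Real.sqrt (2 * Real.pi)) : ℝ) : ℂ) ^ 2 ∨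
         x = ℘'[ofUpperHalfPlane UpperHalfPlane.I] (((c : GaussianInt) : ℂ) / 7) / (2 * ((Real.Gamma (1 / 4) ^ 2 / (2 * Real.sqrt (2 * Real.pi)) : ℝ) : ℂ) ^ 3))}) ≃ₐ[ℚ⟮I⟯]
             (IntermediateField.adjoin ℚ⟮I⟯ {x : ℂ | ∃ c : GaussianInt, ¬ (7 : GaussianInt) ∣ c ∧
        (x = ℘[ofUpperHalfPlane UpperHalfPlane.I] (((c : GaussianInt) : ℂ) / 7) / ((Real.Gamma (1 / 4) ^ 2 / (2 * Real.sqrt (2 * Real.pi)) : ℝ) : ℂ) ^ 2 ∨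
         x = ℘'[ofUpperHalfPlane UpperHalfPlane.I] (((c : GaussianInt) : ℂ) / 7) / (2 * ((Real.Gamma (1 / 4) ^ 2 / (2 * Real.sqrt (2 * Real.pi)) : ℝ) : ℂ) ^ 3))}),
             ((σ ⟨_, Y_mem_adjoin h1⟩ : (IntermediateField.adjoin ℚ⟮I⟯ {x : ℂ | ∃ c : GaussianInt, ¬ (7 : GaussianInt) ∣ c ∧
        (x = ℘[ofUpperHalfPlane UpperHalfPlane.I] (((c : GaussianInt) : ℂ) / 7) / ((Real.Gamma (1 / 4) ^ 2 / (2 * Real.sqrt (2 * Real.pi)) : ℝ) : ℂ) ^ 2 ∨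
         x = ℘'[ofUpperHalfPlane UpperHalfPlane.I] (((c : GaussianInt) : ℂ) / 7) / (2 * ((Real.Gamma (1 / 4) ^ 2 / (2 * Real.sqrt (2 * Real.pi)) : ℝ) : ℂ) ^ 3))})) : ℂ) =
             (℘'[ofUpperHalfPlane UpperHalfPlane.I] (((u σ : GaussianInt) : ℂ) / 7) / (2 * ((Real.Gamma (1 / 4) ^ 2 / (2 * Real.sqrt (2 * Real.pi)) : ℝ) : ℂ) ^ 3)) := fun σ ↦ by
    have h := (husp σ 1 h1).2; rwa [mul_one] at h
  obtain ⟨hX0, hY0, h24, h48⟩ := val_division v h7 h1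
  obtain ⟨-, hr1⟩ := val_t_lt_one v h7 h1
  have heX0 : (⟨_, X_mem_adjoin h1⟩ : (IntermediateField.adjoin ℚ⟮I⟯ {x : ℂ | ∃ c : GaussianInt, ¬ (7 : GaussianInt) ∣ c ∧
        (x = ℘[ofUpperHalfPlane UpperHalfPlane.I] (((c : GaussianInt) : ℂ) / 7) / ((Real.Gamma (1 / 4) ^ 2 / (2 * Real.sqrt (2 * Real.pi)) : ℝ) : ℂ) ^ 2 ∨
         x = ℘'[ofUpperHalfPlane UpperHalfPlane.I] (((c : GaussianInt) : ℂ) / 7) / (2 * ((Real.Gamma (1 / 4) ^ 2 / (2 * Real.sqrt (2 * Real.pi)) : ℝ) : ℂ) ^ 3))})) ≠ 0 := fun h ↦ hX0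
             (congrArg Subtype.val h)
  have heY0 : (⟨_, Y_mem_adjoin h1⟩ : (IntermediateField.adjoin ℚ⟮I⟯ {x : ℂ | ∃ c : GaussianInt, ¬ (7 : GaussianInt) ∣ c ∧
        (x = ℘[ofUpperHalfPlane UpperHalfPlane.I] (((c : GaussianInt) : ℂ) / 7) / ((Real.Gamma (1 / 4) ^ 2 / (2 * Real.sqrt (2 * Real.pi)) : ℝ) : ℂ) ^ 2 ∨
         x = ℘'[ofUpperHalfPlane UpperHalfPlane.I] (((c : GaussianInt) : ℂ) / 7) / (2 * ((Real.Gamma (1 / 4) ^ 2 / (2 * Real.sqrt (2 * Real.pi)) : ℝ) : ℂ) ^ 3))})) ≠ 0 := fun h ↦ hY0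
             (congrArg Subtype.val h)
  -- the valuation restricted to `K₇`
  let vK : Valuation (IntermediateField.adjoin ℚ⟮I⟯ {x : ℂ | ∃ c : GaussianInt, ¬ (7 : GaussianInt) ∣ c ∧
        (x = ℘[ofUpperHalfPlane UpperHalfPlane.I] (((c : GaussianInt) : ℂ) / 7) / ((Real.Gamma (1 / 4) ^ 2 / (2 * Real.sqrt (2 * Real.pi)) : ℝ) : ℂ) ^ 2 ∨
         x = ℘'[ofUpperHalfPlane UpperHalfPlane.I] (((c : GaussianInt) : ℂ) / 7) / (2 * ((Real.Gamma (1 / 4) ^ 2 / (2 * Real.sqrt (2 * Real.pi)) : ℝ) : ℂ) ^ 3))}) Γ₀ := v.comap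
             (algebraMap (IntermediateField.adjoin ℚ⟮I⟯ {x : ℂ | ∃ c : GaussianInt, ¬ (7 : GaussianInt) ∣ c ∧
        (x = ℘[ofUpperHalfPlane UpperHalfPlane.I] (((c : GaussianInt) : ℂ) / 7) / ((Real.Gamma (1 / 4) ^ 2 / (2 * Real.sqrt (2 * Real.pi)) : ℝ) : ℂ) ^ 2 ∨
         x = ℘'[ofUpperHalfPlane UpperHalfPlane.I] (((c : GaussianInt) : ℂ) / 7) / (2 * ((Real.Gamma (1 / 4) ^ 2 / (2 * Real.sqrt (2 * Real.pi)) : ℝ) : ℂ) ^ 3))}) ℂ)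
  have hvK : ∀ x : (IntermediateField.adjoin ℚ⟮I⟯ {x : ℂ | ∃ c : GaussianInt, ¬ (7 : GaussianInt) ∣ c ∧
        (x = ℘[ofUpperHalfPlane UpperHalfPlane.I] (((c : GaussianInt) : ℂ) / 7) / ((Real.Gamma (1 / 4) ^ 2 / (2 * Real.sqrt (2 * Real.pi)) : ℝ) : ℂ) ^ 2 ∨
         x = ℘'[ofUpperHalfPlane UpperHalfPlane.I] (((c : GaussianInt) : ℂ) / 7) / (2 * ((Real.Gamma (1 / 4) ^ 2 / (2 * Real.sqrt (2 * Real.pi)) : ℝ) : ℂ) ^ 3))}), vK x = v (x : ℂ) := fun x ↦ rfl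
  -- the character `χ(σ) = ((u_σ/7)₄^k)⁻¹`, with values in `ℚ(i)`
  let Q : ((IntermediateField.adjoin ℚ⟮I⟯ {x : ℂ | ∃ c : GaussianInt, ¬ (7 : GaussianInt) ∣ c ∧
        (x = ℘[ofUpperHalfPlane UpperHalfPlane.I] (((c : GaussianInt) : ℂ) / 7) / ((Real.Gamma (1 / 4) ^ 2 / (2 * Real.sqrt (2 * Real.pi)) : ℝ) : ℂ) ^ 2 ∨
         x = ℘'[ofUpperHalfPlane UpperHalfPlane.I] (((c : GaussianInt) : ℂ) / 7) / (2 * ((Real.Gamma (1 / 4) ^ 2 / (2 * Real.sqrt (2 * Real.pi)) : ℝ) : ℂ) ^ 3))}) ≃ₐ[ℚ⟮I⟯]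
             (IntermediateField.adjoin ℚ⟮I⟯ {x : ℂ | ∃ c : GaussianInt, ¬ (7 : GaussianInt) ∣ c ∧
        (x = ℘[ofUpperHalfPlane UpperHalfPlane.I] (((c : GaussianInt) : ℂ) / 7) / ((Real.Gamma (1 / 4) ^ 2 / (2 * Real.sqrt (2 * Real.pi)) : ℝ) : ℂ) ^ 2 ∨
         x = ℘'[ofUpperHalfPlane UpperHalfPlane.I] (((c : GaussianInt) : ℂ) / 7) / (2 * ((Real.Gamma (1 / 4) ^ 2 / (2 * Real.sqrt (2 * Real.pi)) : ℝ) : ℂ) ^ 3))})) → ℚ⟮I⟯ := fun σ ↦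
             ⟨((quarticCharMod 7 (u σ) : GaussianInt) : ℂ), toComplex_mem_adjoin_I _⟩
  let χ : ((IntermediateField.adjoin ℚ⟮I⟯ {x : ℂ | ∃ c : GaussianInt, ¬ (7 : GaussianInt) ∣ c ∧
        (x = ℘[ofUpperHalfPlane UpperHalfPlane.I] (((c : GaussianInt) : ℂ) / 7) / ((Real.Gamma (1 / 4) ^ 2 / (2 * Real.sqrt (2 * Real.pi)) : ℝ) : ℂ) ^ 2 ∨
         x = ℘'[ofUpperHalfPlane UpperHalfPlane.I] (((c : GaussianInt) : ℂ) / 7) / (2 * ((Real.Gamma (1 / 4) ^ 2 / (2 * Real.sqrt (2 * Real.pi)) : ℝ) : ℂ) ^ 3))}) ≃ₐ[ℚ⟮I⟯]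
             (IntermediateField.adjoin ℚ⟮I⟯ {x : ℂ | ∃ c : GaussianInt, ¬ (7 : GaussianInt) ∣ c ∧
        (x = ℘[ofUpperHalfPlane UpperHalfPlane.I] (((c : GaussianInt) : ℂ) / 7) / ((Real.Gamma (1 / 4) ^ 2 / (2 * Real.sqrt (2 * Real.pi)) : ℝ) : ℂ) ^ 2 ∨
         x = ℘'[ofUpperHalfPlane UpperHalfPlane.I] (((c : GaussianInt) : ℂ) / 7) / (2 * ((Real.Gamma (1 / 4) ^ 2 / (2 * Real.sqrt (2 * Real.pi)) : ℝ) : ℂ) ^ 3))})) →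
             (IntermediateField.adjoin ℚ⟮I⟯ {x : ℂ | ∃ c : GaussianInt, ¬ (7 : GaussianInt) ∣ c ∧
        (x = ℘[ofUpperHalfPlane UpperHalfPlane.I] (((c : GaussianInt) : ℂ) / 7) / ((Real.Gamma (1 / 4) ^ 2 / (2 * Real.sqrt (2 * Real.pi)) : ℝ) : ℂ) ^ 2 ∨
         x = ℘'[ofUpperHalfPlane UpperHalfPlane.I] (((c : GaussianInt) : ℂ) / 7) / (2 * ((Real.Gamma (1 / 4) ^ 2 / (2 * Real.sqrt (2 * Real.pi)) : ℝ) : ℂ) ^ 3))}) := fun σ ↦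
             ((algebraMap ℚ⟮I⟯ (IntermediateField.adjoin ℚ⟮I⟯ {x : ℂ | ∃ c : GaussianInt, ¬ (7 : GaussianInt) ∣ c ∧
        (x = ℘[ofUpperHalfPlane UpperHalfPlane.I] (((c : GaussianInt) : ℂ) / 7) / ((Real.Gamma (1 / 4) ^ 2 / (2 * Real.sqrt (2 * Real.pi)) : ℝ) : ℂ) ^ 2 ∨
         x = ℘'[ofUpperHalfPlane UpperHalfPlane.I] (((c : GaussianInt) : ℂ) / 7) / (2 * ((Real.Gamma (1 / 4) ^ 2 / (2 * Real.sqrt (2 * Real.pi)) : ℝ) : ℂ) ^ 3))}) (Q σ)) ^ k)⁻¹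
  have hQcoe : ∀ σ, ((algebraMap ℚ⟮I⟯ (IntermediateField.adjoin ℚ⟮I⟯ {x : ℂ | ∃ c : GaussianInt, ¬ (7 : GaussianInt) ∣ c ∧
        (x = ℘[ofUpperHalfPlane UpperHalfPlane.I] (((c : GaussianInt) : ℂ) / 7) / ((Real.Gamma (1 / 4) ^ 2 / (2 * Real.sqrt (2 * Real.pi)) : ℝ) : ℂ) ^ 2 ∨
         x = ℘'[ofUpperHalfPlane UpperHalfPlane.I] (((c : GaussianInt) : ℂ) / 7) / (2 * ((Real.Gamma (1 / 4) ^ 2 / (2 * Real.sqrt (2 * Real.pi)) : ℝ) : ℂ) ^ 3))}) (Q σ) :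
             (IntermediateField.adjoin ℚ⟮I⟯ {x : ℂ | ∃ c : GaussianInt, ¬ (7 : GaussianInt) ∣ c ∧
        (x = ℘[ofUpperHalfPlane UpperHalfPlane.I] (((c : GaussianInt) : ℂ) / 7) / ((Real.Gamma (1 / 4) ^ 2 / (2 * Real.sqrt (2 * Real.pi)) : ℝ) : ℂ) ^ 2 ∨
         x = ℘'[ofUpperHalfPlane UpperHalfPlane.I] (((c : GaussianInt) : ℂ) / 7) / (2 * ((Real.Gamma (1 / 4) ^ 2 / (2 * Real.sqrt (2 * Real.pi)) : ℝ) : ℂ) ^ 3))})) : ℂ) =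
             ((quarticCharMod 7 (u σ) : GaussianInt) : ℂ) := fun σ ↦ rfl
  have hχcoe : ∀ σ, ((χ σ : (IntermediateField.adjoin ℚ⟮I⟯ {x : ℂ | ∃ c : GaussianInt, ¬ (7 : GaussianInt) ∣ c ∧
        (x = ℘[ofUpperHalfPlane UpperHalfPlane.I] (((c : GaussianInt) : ℂ) / 7) / ((Real.Gamma (1 / 4) ^ 2 / (2 * Real.sqrt (2 * Real.pi)) : ℝ) : ℂ) ^ 2 ∨
         x = ℘'[ofUpperHalfPlane UpperHalfPlane.I] (((c : GaussianInt) : ℂ) / 7) / (2 * ((Real.Gamma (1 / 4) ^ 2 / (2 * Real.sqrt (2 * Real.pi)) : ℝ) : ℂ) ^ 3))})) : ℂ) =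
             ((((quarticCharMod 7 (u σ) : GaussianInt) : ℂ)) ^ k)⁻¹ := fun σ ↦ by
    show (((((algebraMap ℚ⟮I⟯ (IntermediateField.adjoin ℚ⟮I⟯ {x : ℂ | ∃ c : GaussianInt, ¬ (7 : GaussianInt) ∣ c ∧
        (x = ℘[ofUpperHalfPlane UpperHalfPlane.I] (((c : GaussianInt) : ℂ) / 7) / ((Real.Gamma (1 / 4) ^ 2 / (2 * Real.sqrt (2 * Real.pi)) : ℝ) : ℂ) ^ 2 ∨
         x = ℘'[ofUpperHalfPlane UpperHalfPlane.I] (((c : GaussianInt) : ℂ) / 7) / (2 * ((Real.Gamma (1 / 4) ^ 2 / (2 * Real.sqrt (2 * Real.pi)) : ℝ) : ℂ) ^ 3))}) (Q σ)) ^ k)⁻¹ :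
             (IntermediateField.adjoin ℚ⟮I⟯ {x : ℂ | ∃ c : GaussianInt, ¬ (7 : GaussianInt) ∣ c ∧
        (x = ℘[ofUpperHalfPlane UpperHalfPlane.I] (((c : GaussianInt) : ℂ) / 7) / ((Real.Gamma (1 / 4) ^ 2 / (2 * Real.sqrt (2 * Real.pi)) : ℝ) : ℂ) ^ 2 ∨
         x = ℘'[ofUpperHalfPlane UpperHalfPlane.I] (((c : GaussianInt) : ℂ) / 7) / (2 * ((Real.Gamma (1 / 4) ^ 2 / (2 * Real.sqrt (2 * Real.pi)) : ℝ) : ℂ) ^ 3))}))) : ℂ) = _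
    rw [IntermediateField.coe_inv, IntermediateField.coe_pow, hQcoe]
  have hvq : ∀ σ, v ((quarticCharMod 7 (u σ) : GaussianInt) : ℂ) = 1 := fun σ ↦ (val_quarticCharMod_eq_one v h7 (hu σ)).1
  -- ★ the tame resolvent count
  have hmain := resolvent_valuation_le vK (G := (IntermediateField.adjoin ℚ⟮I⟯ {x : ℂ | ∃ c : GaussianInt, ¬ (7 : GaussianInt) ∣ c ∧
        (x = ℘[ofUpperHalfPlane UpperHalfPlane.I] (((c : GaussianInt) : ℂ) / 7) / ((Real.Gamma (1 / 4) ^ 2 / (2 * Real.sqrt (2 * Real.pi)) : ℝ) : ℂ) ^ 2 ∨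
         x = ℘'[ofUpperHalfPlane UpperHalfPlane.I] (((c : GaussianInt) : ℂ) / 7) / (2 * ((Real.Gamma (1 / 4) ^ 2 / (2 * Real.sqrt (2 * Real.pi)) : ℝ) : ℂ) ^ 3))}) ≃ₐ[ℚ⟮I⟯]
             (IntermediateField.adjoin ℚ⟮I⟯ {x : ℂ | ∃ c : GaussianInt, ¬ (7 : GaussianInt) ∣ c ∧
        (x = ℘[ofUpperHalfPlane UpperHalfPlane.I] (((c : GaussianInt) : ℂ) / 7) / ((Real.Gamma (1 / 4) ^ 2 / (2 * Real.sqrt (2 * Real.pi)) : ℝ) : ℂ) ^ 2 ∨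
         x = ℘'[ofUpperHalfPlane UpperHalfPlane.I] (((c : GaussianInt) : ℂ) / 7) / (2 * ((Real.Gamma (1 / 4) ^ 2 / (2 * Real.sqrt (2 * Real.pi)) : ℝ) : ℂ) ^ 3))}))
    (fun σ x ↦ by rw [AlgEquiv.smul_def, hvK, hvK]; exact (val_algEquiv_apply v h7 σ (hu σ) (huspX σ) (huspY σ) x).1)
    (fun σ x hx ↦ by
      rw [AlgEquiv.smul_def, hvK]; rw [hvK] at hx; exact (val_algEquiv_apply v h7 σ (hu σ) (huspX σ) (huspY σ) x).2 hx)
    (ϖ := (⟨_, X_mem_adjoin h1⟩ : (IntermediateField.adjoin ℚ⟮I⟯ {x : ℂ | ∃ c : GaussianInt, ¬ (7 : GaussianInt) ∣ c ∧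
        (x = ℘[ofUpperHalfPlane UpperHalfPlane.I] (((c : GaussianInt) : ℂ) / 7) / ((Real.Gamma (1 / 4) ^ 2 / (2 * Real.sqrt (2 * Real.pi)) : ℝ) : ℂ) ^ 2 ∨
         x = ℘'[ofUpperHalfPlane UpperHalfPlane.I] (((c : GaussianInt) : ℂ) / 7) / (2 * ((Real.Gamma (1 / 4) ^ 2 / (2 * Real.sqrt (2 * Real.pi)) : ℝ) : ℂ) ^ 3))})) / ⟨_, Y_mem_adjoin h1⟩)
             (div_ne_zero heX0 heY0) (by rw [hvK, coe_t]; exact hr1)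
    (fun x hx ↦ by rw [hvK, hvK, coe_t]; exact exists_val_coe_eq_zpow v h7 hx) (e := 48)
    (fun m hm ↦ dvd_fortyEight_of_forall_algEquiv v h7 (fun σ ↦ by have h := hm σ; rwa [AlgEquiv.smul_def, hvK] at h))
    χ ?_ ?_ ?_ (j := 48 - 12 * k) (by omega) ?_ (y := (⟨_, X_mem_adjoin h1⟩ : (IntermediateField.adjoin ℚ⟮I⟯ {x : ℂ | ∃ c : GaussianInt, ¬ (7 : GaussianInt) ∣ c ∧
        (x = ℘[ofUpperHalfPlane UpperHalfPlane.I] (((c : GaussianInt) : ℂ) / 7) / ((Real.Gamma (1 / 4) ^ 2 / (2 * Real.sqrt (2 * Real.pi)) : ℝ) : ℂ) ^ 2 ∨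
         x = ℘'[ofUpperHalfPlane UpperHalfPlane.I] (((c : GaussianInt) : ℂ) / 7) / (2 * ((Real.Gamma (1 / 4) ^ 2 / (2 * Real.sqrt (2 * Real.pi)) : ℝ) : ℂ) ^ 3))}))⁻¹ ^ n) ?_
  rotate_left
  · -- `hχ`: multiplicativity (`u_{στ} ≡ u_σ u_τ`)
    intro σ τ
    have hστ : (7 : GaussianInt) ∣ u (σ * τ) - u σ * u τ := by
      refine dvd_sub_of_X_Y_eq (hu _) (not_seven_dvd_mul (hu σ) (hu τ)) ?_ ?_
      · have e1 : (τ ⟨_, X_mem_adjoin h1⟩ : (IntermediateField.adjoin ℚ⟮I⟯ {x : ℂ | ∃ c : GaussianInt, ¬ (7 : GaussianInt) ∣ c ∧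
        (x = ℘[ofUpperHalfPlane UpperHalfPlane.I] (((c : GaussianInt) : ℂ) / 7) / ((Real.Gamma (1 / 4) ^ 2 / (2 * Real.sqrt (2 * Real.pi)) : ℝ) : ℂ) ^ 2 ∨
         x = ℘'[ofUpperHalfPlane UpperHalfPlane.I] (((c : GaussianInt) : ℂ) / 7) / (2 * ((Real.Gamma (1 / 4) ^ 2 / (2 * Real.sqrt (2 * Real.pi)) : ℝ) : ℂ) ^ 3))})) = ⟨_, X_mem_adjoin (hu τ)⟩ :=
             Subtype.ext (huspX τ)
        rw [← huspX (σ * τ), AlgEquiv.mul_apply, e1, (husp σ (u τ) (hu τ)).1]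
      · have e1 : (τ ⟨_, Y_mem_adjoin h1⟩ : (IntermediateField.adjoin ℚ⟮I⟯ {x : ℂ | ∃ c : GaussianInt, ¬ (7 : GaussianInt) ∣ c ∧
        (x = ℘[ofUpperHalfPlane UpperHalfPlane.I] (((c : GaussianInt) : ℂ) / 7) / ((Real.Gamma (1 / 4) ^ 2 / (2 * Real.sqrt (2 * Real.pi)) : ℝ) : ℂ) ^ 2 ∨
         x = ℘'[ofUpperHalfPlane UpperHalfPlane.I] (((c : GaussianInt) : ℂ) / 7) / (2 * ((Real.Gamma (1 / 4) ^ 2 / (2 * Real.sqrt (2 * Real.pi)) : ℝ) : ℂ) ^ 3))})) = ⟨_, Y_mem_adjoin (hu τ)⟩ :=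
             Subtype.ext (huspY τ)
        rw [← huspY (σ * τ), AlgEquiv.mul_apply, e1, (husp σ (u τ) (hu τ)).2]
    have hQ : Q (σ * τ) = Q σ * Q τ := by
      apply Subtype.ext
      show (((quarticCharMod 7 (u (σ * τ)) : GaussianInt) : ℂ)) =
        ((quarticCharMod 7 (u σ) : GaussianInt) : ℂ) * ((quarticCharMod 7 (u τ) : GaussianInt) : ℂ)
      rw [← map_mul, ← quarticCharMod_mul]
      congr 1
      exact quarticCharMod_eq_of_dvd_sub (a := 7) (by exact_mod_cast hστ)
    show ((algebraMap ℚ⟮I⟯ (IntermediateField.adjoin ℚ⟮I⟯ {x : ℂ | ∃ c : GaussianInt, ¬ (7 : GaussianInt) ∣ c ∧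
        (x = ℘[ofUpperHalfPlane UpperHalfPlane.I] (((c : GaussianInt) : ℂ) / 7) / ((Real.Gamma (1 / 4) ^ 2 / (2 * Real.sqrt (2 * Real.pi)) : ℝ) : ℂ) ^ 2 ∨
         x = ℘'[ofUpperHalfPlane UpperHalfPlane.I] (((c : GaussianInt) : ℂ) / 7) / (2 * ((Real.Gamma (1 / 4) ^ 2 / (2 * Real.sqrt (2 * Real.pi)) : ℝ) : ℂ) ^ 3))}) (Q (σ * τ))) ^ k)⁻¹ =
             ((algebraMap ℚ⟮I⟯ (IntermediateField.adjoin ℚ⟮I⟯ {x : ℂ | ∃ c : GaussianInt, ¬ (7 : GaussianInt) ∣ c ∧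
        (x = ℘[ofUpperHalfPlane UpperHalfPlane.I] (((c : GaussianInt) : ℂ) / 7) / ((Real.Gamma (1 / 4) ^ 2 / (2 * Real.sqrt (2 * Real.pi)) : ℝ) : ℂ) ^ 2 ∨
         x = ℘'[ofUpperHalfPlane UpperHalfPlane.I] (((c : GaussianInt) : ℂ) / 7) / (2 * ((Real.Gamma (1 / 4) ^ 2 / (2 * Real.sqrt (2 * Real.pi)) : ℝ) : ℂ) ^ 3))}) (Q σ)) ^ k)⁻¹ *
             ((algebraMap ℚ⟮I⟯ (IntermediateField.adjoin ℚ⟮I⟯ {x : ℂ | ∃ c : GaussianInt, ¬ (7 : GaussianInt) ∣ c ∧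
        (x = ℘[ofUpperHalfPlane UpperHalfPlane.I] (((c : GaussianInt) : ℂ) / 7) / ((Real.Gamma (1 / 4) ^ 2 / (2 * Real.sqrt (2 * Real.pi)) : ℝ) : ℂ) ^ 2 ∨
         x = ℘'[ofUpperHalfPlane UpperHalfPlane.I] (((c : GaussianInt) : ℂ) / 7) / (2 * ((Real.Gamma (1 / 4) ^ 2 / (2 * Real.sqrt (2 * Real.pi)) : ℝ) : ℂ) ^ 3))}) (Q τ)) ^ k)⁻¹
    rw [hQ, map_mul, mul_pow, mul_inv]
  · -- `hχ1`
    intro σ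
    rw [hvK, hχcoe, map_inv₀, Valuation.map_pow, hvq, one_pow, inv_one]
  · -- `hχfix`: values in `ℚ(i)`
    intro σ τ
    show σ (((algebraMap ℚ⟮I⟯ (IntermediateField.adjoin ℚ⟮I⟯ {x : ℂ | ∃ c : GaussianInt, ¬ (7 : GaussianInt) ∣ c ∧
        (x = ℘[ofUpperHalfPlane UpperHalfPlane.I] (((c : GaussianInt) : ℂ) / 7) / ((Real.Gamma (1 / 4) ^ 2 / (2 * Real.sqrt (2 * Real.pi)) : ℝ) : ℂ) ^ 2 ∨
         x = ℘'[ofUpperHalfPlane UpperHalfPlane.I] (((c : GaussianInt) : ℂ) / 7) / (2 * ((Real.Gamma (1 / 4) ^ 2 / (2 * Real.sqrt (2 * Real.pi)) : ℝ) : ℂ) ^ 3))}) (Q τ)) ^ k)⁻¹) =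
             ((algebraMap ℚ⟮I⟯ (IntermediateField.adjoin ℚ⟮I⟯ {x : ℂ | ∃ c : GaussianInt, ¬ (7 : GaussianInt) ∣ c ∧
        (x = ℘[ofUpperHalfPlane UpperHalfPlane.I] (((c : GaussianInt) : ℂ) / 7) / ((Real.Gamma (1 / 4) ^ 2 / (2 * Real.sqrt (2 * Real.pi)) : ℝ) : ℂ) ^ 2 ∨
         x = ℘'[ofUpperHalfPlane UpperHalfPlane.I] (((c : GaussianInt) : ℂ) / 7) / (2 * ((Real.Gamma (1 / 4) ^ 2 / (2 * Real.sqrt (2 * Real.pi)) : ℝ) : ℂ) ^ 3))}) (Q τ)) ^ k)⁻¹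
    rw [map_inv₀, map_pow, AlgEquiv.commutes]
  · -- `hχθ`: `χ ≡ θ^{48−12k}`
    intro σ
    rw [hvK, AddSubgroupClass.coe_sub, hχcoe, IntermediateField.coe_pow, IntermediateField.coe_div, AlgEquiv.smul_def,
      coe_algEquiv_t σ (huspX σ) (huspY σ), coe_t]
    exact val_inv_pow_sub_theta_pow_lt v h7 (hu σ) (by omega)
  · -- `hy`: `X_1⁻ⁿ` is integral
    rw [hvK, IntermediateField.coe_pow, IntermediateField.coe_inv, Valuation.map_pow]
    refine pow_le_one₀ zero_le ?_
    by_contra hge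
    push Not at hge
    have : (1 : Γ₀) ≤ v ((℘[ofUpperHalfPlane UpperHalfPlane.I] (((1 : GaussianInt) : ℂ) / 7) / ((Real.Gamma (1 / 4) ^ 2 / (2 * Real.sqrt (2 * Real.pi)) : ℝ) : ℂ) ^ 2))⁻¹ ^ 24 := one_le_pow₀
        hge.le
    rw [h24] at this
    exact absurd h7 (not_lt.mpr this)
  -- ★ identify the resolvent with the sum over the classes: the bijection `σ ↦ b` with `c b ≡ u_σ`
  have hcsurj : ∀ σ : (IntermediateField.adjoin ℚ⟮I⟯ {x : ℂ | ∃ c : GaussianInt, ¬ (7 : GaussianInt) ∣ c ∧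
        (x = ℘[ofUpperHalfPlane UpperHalfPlane.I] (((c : GaussianInt) : ℂ) / 7) / ((Real.Gamma (1 / 4) ^ 2 / (2 * Real.sqrt (2 * Real.pi)) : ℝ) : ℂ) ^ 2 ∨
         x = ℘'[ofUpperHalfPlane UpperHalfPlane.I] (((c : GaussianInt) : ℂ) / 7) / (2 * ((Real.Gamma (1 / 4) ^ 2 / (2 * Real.sqrt (2 * Real.pi)) : ℝ) : ℂ) ^ 3))}) ≃ₐ[ℚ⟮I⟯]
             (IntermediateField.adjoin ℚ⟮I⟯ {x : ℂ | ∃ c : GaussianInt, ¬ (7 : GaussianInt) ∣ c ∧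
        (x = ℘[ofUpperHalfPlane UpperHalfPlane.I] (((c : GaussianInt) : ℂ) / 7) / ((Real.Gamma (1 / 4) ^ 2 / (2 * Real.sqrt (2 * Real.pi)) : ℝ) : ℂ) ^ 2 ∨
         x = ℘'[ofUpperHalfPlane UpperHalfPlane.I] (((c : GaussianInt) : ℂ) / 7) / (2 * ((Real.Gamma (1 / 4) ^ 2 / (2 * Real.sqrt (2 * Real.pi)) : ℝ) : ℂ) ^ 3))}), ∃ b : ZMod 7 × ZMod 7,
             (7 : GaussianInt) ∣ u σ - c b := by
    intro σ
    have hinj : Function.Injective (fun b ↦ cls 7 (c b)) := fun b b' h ↦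
      (hcinj b' b ((cls_eq_cls_iff 7 _ _).mp h)).symm
    obtain ⟨b, hb⟩ := (Finite.surjective_of_injective hinj) (cls 7 (u σ))
    exact ⟨b, (cls_eq_cls_iff 7 _ _).mp hb⟩
  choose β hβ using hcsurj
  have hβ0 : ∀ σ, β σ ≠ 0 := fun σ h ↦ hu σ (by
    have h2 : (7 : GaussianInt) ∣ c (β σ) := (hc0 _).mpr h
    have := dvd_add (hβ σ) h2; rwa [sub_add_cancel] at this)
  let β' : ((IntermediateField.adjoin ℚ⟮I⟯ {x : ℂ | ∃ c : GaussianInt, ¬ (7 : GaussianInt) ∣ c ∧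
        (x = ℘[ofUpperHalfPlane UpperHalfPlane.I] (((c : GaussianInt) : ℂ) / 7) / ((Real.Gamma (1 / 4) ^ 2 / (2 * Real.sqrt (2 * Real.pi)) : ℝ) : ℂ) ^ 2 ∨
         x = ℘'[ofUpperHalfPlane UpperHalfPlane.I] (((c : GaussianInt) : ℂ) / 7) / (2 * ((Real.Gamma (1 / 4) ^ 2 / (2 * Real.sqrt (2 * Real.pi)) : ℝ) : ℂ) ^ 3))}) ≃ₐ[ℚ⟮I⟯]
             (IntermediateField.adjoin ℚ⟮I⟯ {x : ℂ | ∃ c : GaussianInt, ¬ (7 : GaussianInt) ∣ c ∧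
        (x = ℘[ofUpperHalfPlane UpperHalfPlane.I] (((c : GaussianInt) : ℂ) / 7) / ((Real.Gamma (1 / 4) ^ 2 / (2 * Real.sqrt (2 * Real.pi)) : ℝ) : ℂ) ^ 2 ∨
         x = ℘'[ofUpperHalfPlane UpperHalfPlane.I] (((c : GaussianInt) : ℂ) / 7) / (2 * ((Real.Gamma (1 / 4) ^ 2 / (2 * Real.sqrt (2 * Real.pi)) : ℝ) : ℂ) ^ 3))})) →
             {b : ZMod 7 × ZMod 7 // b ≠ 0} := fun σ ↦ ⟨β σ, hβ0 σ⟩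
  have hβinj : Function.Injective β' := by
    intro σ τ h
    have h' : β σ = β τ := congrArg Subtype.val h
    have hdvd : (7 : GaussianInt) ∣ u σ - u τ := by
      have := dvd_sub (hβ σ) (hβ τ); rw [h'] at this; simpa using this
    exact algEquiv_eq_of_dvd_sub (husp σ) (husp τ) hdvd
  have htarget : Fintype.card {b : ZMod 7 × ZMod 7 // b ≠ 0} = 48 := by decide
  have hβbij : Function.Bijective β' := by
    rw [Fintype.bijective_iff_injective_and_card]
    exact ⟨hβinj, by rw [← Nat.card_eq_fintype_card, hcard, htarget]⟩
  -- the terms only depend on the class modulo `7`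
  have hterm : ∀ σ : (IntermediateField.adjoin ℚ⟮I⟯ {x : ℂ | ∃ c : GaussianInt, ¬ (7 : GaussianInt) ∣ c ∧
        (x = ℘[ofUpperHalfPlane UpperHalfPlane.I] (((c : GaussianInt) : ℂ) / 7) / ((Real.Gamma (1 / 4) ^ 2 / (2 * Real.sqrt (2 * Real.pi)) : ℝ) : ℂ) ^ 2 ∨
         x = ℘'[ofUpperHalfPlane UpperHalfPlane.I] (((c : GaussianInt) : ℂ) / 7) / (2 * ((Real.Gamma (1 / 4) ^ 2 / (2 * Real.sqrt (2 * Real.pi)) : ℝ) : ℂ) ^ 3))}) ≃ₐ[ℚ⟮I⟯]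
             (IntermediateField.adjoin ℚ⟮I⟯ {x : ℂ | ∃ c : GaussianInt, ¬ (7 : GaussianInt) ∣ c ∧
        (x = ℘[ofUpperHalfPlane UpperHalfPlane.I] (((c : GaussianInt) : ℂ) / 7) / ((Real.Gamma (1 / 4) ^ 2 / (2 * Real.sqrt (2 * Real.pi)) : ℝ) : ℂ) ^ 2 ∨
         x = ℘'[ofUpperHalfPlane UpperHalfPlane.I] (((c : GaussianInt) : ℂ) / 7) / (2 * ((Real.Gamma (1 / 4) ^ 2 / (2 * Real.sqrt (2 * Real.pi)) : ℝ) : ℂ) ^ 3))}),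
             (((quarticCharMod 7 (u σ) : GaussianInt) : ℂ)) ^ k *
             ((℘[ofUpperHalfPlane UpperHalfPlane.I] (((u σ : GaussianInt) : ℂ) / 7) / ((Real.Gamma (1 / 4) ^ 2 / (2 * Real.sqrt (2 * Real.pi)) : ℝ) : ℂ) ^ 2))⁻¹ ^ n =
      (((quarticCharMod 7 (c (β σ)) : GaussianInt) : ℂ)) ^ k *
          ((℘[ofUpperHalfPlane UpperHalfPlane.I] (((c (β σ) : GaussianInt) : ℂ) / 7) / ((Real.Gamma (1 / 4) ^ 2 / (2 * Real.sqrt (2 * Real.pi)) : ℝ) : ℂ) ^ 2))⁻¹ ^ n := by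
    intro σ
    rw [quarticCharMod_eq_of_dvd_sub (a := 7) (by exact_mod_cast hβ σ), (X_Y_eq_of_dvd_sub (hβ σ)).1]
  have hlhs : ∀ σ : (IntermediateField.adjoin ℚ⟮I⟯ {x : ℂ | ∃ c : GaussianInt, ¬ (7 : GaussianInt) ∣ c ∧
        (x = ℘[ofUpperHalfPlane UpperHalfPlane.I] (((c : GaussianInt) : ℂ) / 7) / ((Real.Gamma (1 / 4) ^ 2 / (2 * Real.sqrt (2 * Real.pi)) : ℝ) : ℂ) ^ 2 ∨
         x = ℘'[ofUpperHalfPlane UpperHalfPlane.I] (((c : GaussianInt) : ℂ) / 7) / (2 * ((Real.Gamma (1 / 4) ^ 2 / (2 * Real.sqrt (2 * Real.pi)) : ℝ) : ℂ) ^ 3))}) ≃ₐ[ℚ⟮I⟯]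
             (IntermediateField.adjoin ℚ⟮I⟯ {x : ℂ | ∃ c : GaussianInt, ¬ (7 : GaussianInt) ∣ c ∧
        (x = ℘[ofUpperHalfPlane UpperHalfPlane.I] (((c : GaussianInt) : ℂ) / 7) / ((Real.Gamma (1 / 4) ^ 2 / (2 * Real.sqrt (2 * Real.pi)) : ℝ) : ℂ) ^ 2 ∨
         x = ℘'[ofUpperHalfPlane UpperHalfPlane.I] (((c : GaussianInt) : ℂ) / 7) / (2 * ((Real.Gamma (1 / 4) ^ 2 / (2 * Real.sqrt (2 * Real.pi)) : ℝ) : ℂ) ^ 3))}),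
      ((((χ σ)⁻¹ * σ • ((⟨_, X_mem_adjoin h1⟩ : (IntermediateField.adjoin ℚ⟮I⟯ {x : ℂ | ∃ c : GaussianInt, ¬ (7 : GaussianInt) ∣ c ∧
        (x = ℘[ofUpperHalfPlane UpperHalfPlane.I] (((c : GaussianInt) : ℂ) / 7) / ((Real.Gamma (1 / 4) ^ 2 / (2 * Real.sqrt (2 * Real.pi)) : ℝ) : ℂ) ^ 2 ∨
         x = ℘'[ofUpperHalfPlane UpperHalfPlane.I] (((c : GaussianInt) : ℂ) / 7) / (2 * ((Real.Gamma (1 / 4) ^ 2 / (2 * Real.sqrt (2 * Real.pi)) : ℝ) : ℂ) ^ 3))}))⁻¹ ^ n) :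
             (IntermediateField.adjoin ℚ⟮I⟯ {x : ℂ | ∃ c : GaussianInt, ¬ (7 : GaussianInt) ∣ c ∧
        (x = ℘[ofUpperHalfPlane UpperHalfPlane.I] (((c : GaussianInt) : ℂ) / 7) / ((Real.Gamma (1 / 4) ^ 2 / (2 * Real.sqrt (2 * Real.pi)) : ℝ) : ℂ) ^ 2 ∨
         x = ℘'[ofUpperHalfPlane UpperHalfPlane.I] (((c : GaussianInt) : ℂ) / 7) / (2 * ((Real.Gamma (1 / 4) ^ 2 / (2 * Real.sqrt (2 * Real.pi)) : ℝ) : ℂ) ^ 3))}))) : ℂ) =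
      (((quarticCharMod 7 (u σ) : GaussianInt) : ℂ)) ^ k *
          ((℘[ofUpperHalfPlane UpperHalfPlane.I] (((u σ : GaussianInt) : ℂ) / 7) / ((Real.Gamma (1 / 4) ^ 2 / (2 * Real.sqrt (2 * Real.pi)) : ℝ) : ℂ) ^ 2))⁻¹ ^ n := by
    intro σ
    rw [IntermediateField.coe_mul, IntermediateField.coe_inv, hχcoe, inv_inv, AlgEquiv.smul_def, map_pow, map_inv₀,
      IntermediateField.coe_pow, IntermediateField.coe_inv, huspX σ]
  have hsum_eq : ((((∑ σ : (IntermediateField.adjoin ℚ⟮I⟯ {x : ℂ | ∃ c : GaussianInt, ¬ (7 : GaussianInt) ∣ c ∧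
        (x = ℘[ofUpperHalfPlane UpperHalfPlane.I] (((c : GaussianInt) : ℂ) / 7) / ((Real.Gamma (1 / 4) ^ 2 / (2 * Real.sqrt (2 * Real.pi)) : ℝ) : ℂ) ^ 2 ∨
         x = ℘'[ofUpperHalfPlane UpperHalfPlane.I] (((c : GaussianInt) : ℂ) / 7) / (2 * ((Real.Gamma (1 / 4) ^ 2 / (2 * Real.sqrt (2 * Real.pi)) : ℝ) : ℂ) ^ 3))}) ≃ₐ[ℚ⟮I⟯]
             (IntermediateField.adjoin ℚ⟮I⟯ {x : ℂ | ∃ c : GaussianInt, ¬ (7 : GaussianInt) ∣ c ∧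
        (x = ℘[ofUpperHalfPlane UpperHalfPlane.I] (((c : GaussianInt) : ℂ) / 7) / ((Real.Gamma (1 / 4) ^ 2 / (2 * Real.sqrt (2 * Real.pi)) : ℝ) : ℂ) ^ 2 ∨
         x = ℘'[ofUpperHalfPlane UpperHalfPlane.I] (((c : GaussianInt) : ℂ) / 7) / (2 * ((Real.Gamma (1 / 4) ^ 2 / (2 * Real.sqrt (2 * Real.pi)) : ℝ) : ℂ) ^ 3))}), (χ σ)⁻¹ * σ •
             ((⟨_, X_mem_adjoin h1⟩ : (IntermediateField.adjoin ℚ⟮I⟯ {x : ℂ | ∃ c : GaussianInt, ¬ (7 : GaussianInt) ∣ c ∧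
        (x = ℘[ofUpperHalfPlane UpperHalfPlane.I] (((c : GaussianInt) : ℂ) / 7) / ((Real.Gamma (1 / 4) ^ 2 / (2 * Real.sqrt (2 * Real.pi)) : ℝ) : ℂ) ^ 2 ∨
         x = ℘'[ofUpperHalfPlane UpperHalfPlane.I] (((c : GaussianInt) : ℂ) / 7) / (2 * ((Real.Gamma (1 / 4) ^ 2 / (2 * Real.sqrt (2 * Real.pi)) : ℝ) : ℂ) ^ 3))}))⁻¹ ^ n)) :
             (IntermediateField.adjoin ℚ⟮I⟯ {x : ℂ | ∃ c : GaussianInt, ¬ (7 : GaussianInt) ∣ c ∧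
        (x = ℘[ofUpperHalfPlane UpperHalfPlane.I] (((c : GaussianInt) : ℂ) / 7) / ((Real.Gamma (1 / 4) ^ 2 / (2 * Real.sqrt (2 * Real.pi)) : ℝ) : ℂ) ^ 2 ∨
         x = ℘'[ofUpperHalfPlane UpperHalfPlane.I] (((c : GaussianInt) : ℂ) / 7) / (2 * ((Real.Gamma (1 / 4) ^ 2 / (2 * Real.sqrt (2 * Real.pi)) : ℝ) : ℂ) ^ 3))}))) : ℂ) =
      ∑ b : ZMod 7 × ZMod 7, ((quarticCharMod 7 (c b) : GaussianInt) : ℂ) ^ k *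
          ((℘[ofUpperHalfPlane UpperHalfPlane.I] (((c b : GaussianInt) : ℂ) / 7) / ((Real.Gamma (1 / 4) ^ 2 / (2 * Real.sqrt (2 * Real.pi)) : ℝ) : ℂ) ^ 2))⁻¹ ^ n := by
    rw [IntermediateField.coe_sum, Finset.sum_congr rfl fun σ _ ↦ hlhs σ,
      Fintype.sum_bijective β' hβbij _
          (fun b' ↦ ((quarticCharMod 7 (c b'.1) : GaussianInt) : ℂ) ^ k *
          ((℘[ofUpperHalfPlane UpperHalfPlane.I] (((c b'.1 : GaussianInt) : ℂ) / 7) / ((Real.Gamma (1 / 4) ^ 2 / (2 * Real.sqrt (2 * Real.pi)) : ℝ) : ℂ) ^ 2))⁻¹ ^ n)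
        (fun σ ↦ hterm σ)]
    -- `Σ_{b ≠ 0} = Σ_b` (the `b = 0` term vanishes)
    have hzero : ((quarticCharMod 7 (c 0) : GaussianInt) : ℂ) ^ k *
        ((℘[ofUpperHalfPlane UpperHalfPlane.I] (((c 0 : GaussianInt) : ℂ) / 7) / ((Real.Gamma (1 / 4) ^ 2 / (2 * Real.sqrt (2 * Real.pi)) : ℝ) : ℂ) ^ 2))⁻¹ ^ n = 0 := by
      have : quarticCharMod 7 (c 0) = 0 :=
        (quarticCharMod_natCast_eq_zero_iff (q := 7) (by norm_num) (by norm_num) _).mpr (by exact_mod_cast (hc0 0).mpr rfl)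
      rw [this, map_zero, zero_pow (by omega), zero_mul]
    rw [← Finset.sum_subtype (Finset.univ.filter (fun b : ZMod 7 × ZMod 7 ↦ b ≠ 0)) (fun b ↦ by simp)
      (fun b ↦ ((quarticCharMod 7 (c b) : GaussianInt) : ℂ) ^ k *
          ((℘[ofUpperHalfPlane UpperHalfPlane.I] (((c b : GaussianInt) : ℂ) / 7) / ((Real.Gamma (1 / 4) ^ 2 / (2 * Real.sqrt (2 * Real.pi)) : ℝ) : ℂ) ^ 2))⁻¹ ^ n)]
    exact Finset.sum_filter_of_ne fun b _ hb h0 ↦ hb (by rw [h0]; exact hzero)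
  -- conclude
  have hfinal : v (∑ b : ZMod 7 × ZMod 7, ((quarticCharMod 7 (c b) : GaussianInt) : ℂ) ^ k *
      ((℘[ofUpperHalfPlane UpperHalfPlane.I] (((c b : GaussianInt) : ℂ) / 7) / ((Real.Gamma (1 / 4) ^ 2 / (2 * Real.sqrt (2 * Real.pi)) : ℝ) : ℂ) ^ 2))⁻¹ ^ n) ≤
      v ((℘[ofUpperHalfPlane UpperHalfPlane.I] (((1 : GaussianInt) : ℂ) / 7) / ((Real.Gamma (1 / 4) ^ 2 / (2 * Real.sqrt (2 * Real.pi)) : ℝ) : ℂ) ^ 2) /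
          (℘'[ofUpperHalfPlane UpperHalfPlane.I] (((1 : GaussianInt) : ℂ) / 7) / (2 * ((Real.Gamma (1 / 4) ^ 2 / (2 * Real.sqrt (2 * Real.pi)) : ℝ) : ℂ) ^ 3))) ^ (48 - 12 * k) := by
    rw [← hsum_eq, ← hvK, ← coe_t, ← hvK]; exact hmain
  calc v (∑ b : ZMod 7 × ZMod 7, ((quarticCharMod 7 (c b) : GaussianInt) : ℂ) ^ k *
      ((℘[ofUpperHalfPlane UpperHalfPlane.I] (((c b : GaussianInt) : ℂ) / 7) / ((Real.Gamma (1 / 4) ^ 2 / (2 * Real.sqrt (2 * Real.pi)) : ℝ) : ℂ) ^ 2))⁻¹ ^ n) ^ 4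
      ≤ (v ((℘[ofUpperHalfPlane UpperHalfPlane.I] (((1 : GaussianInt) : ℂ) / 7) / ((Real.Gamma (1 / 4) ^ 2 / (2 * Real.sqrt (2 * Real.pi)) : ℝ) : ℂ) ^ 2) /
          (℘'[ofUpperHalfPlane UpperHalfPlane.I] (((1 : GaussianInt) : ℂ) / 7) / (2 * ((Real.Gamma (1 / 4) ^ 2 / (2 * Real.sqrt (2 * Real.pi)) : ℝ) : ℂ) ^ 3))) ^ (48 - 12 * k)) ^ 4 :=
          pow_le_pow_left₀ zero_le hfinal 4
    _ = (v ((℘[ofUpperHalfPlane UpperHalfPlane.I] (((1 : GaussianInt) : ℂ) / 7) / ((Real.Gamma (1 / 4) ^ 2 / (2 * Real.sqrt (2 * Real.pi)) : ℝ) : ℂ) ^ 2) /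
        (℘'[ofUpperHalfPlane UpperHalfPlane.I] (((1 : GaussianInt) : ℂ) / 7) / (2 * ((Real.Gamma (1 / 4) ^ 2 / (2 * Real.sqrt (2 * Real.pi)) : ℝ) : ℂ) ^ 3))) ^ 48) ^ (4 - k) := by
        rw [← pow_mul, ← pow_mul]; congr 1; omega
    _ = v 7 ^ (4 - k) := by rw [h48]

/-- ★★★ **`RES₇` — the hypothesis `hRES` of `…StubS7OfResolventBound.stub_S7_of_resolventBound`, VERBATIM.** For `1 ≤ k ≤ 3`, `n ≥ 1` and
every valuation `v` of `ℂ` with `v 7 < 1`: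
`v(Σ_{b ∈ (ℤ/7)²} conj((rep b/7)₄)^k · (℘(conj(rep b)/7)/ϖ₀²)⁻ⁿ)⁴ ≤ v(7)^{4−k}` (labelling `b ↦ conj(rep 7 b 0)`; `conj((x/7)₄) = (x̄/7)₄`).
With bed-w2 g10's closer this proves the registered stub `stub_S7` of crux `ManinDatumSupercuspidalCMInert` (the crux itself also needs `stub_S5`;
Manin's conjecture / BSD are NOT proved by this). [cite: Serre1979, Ch. IV §2 Prop. 7] [cite: IrelandRosen1982, Ch. 9 §8 Prop. 9.8.3 (c)] -/
theorem resolventBound_seven : ∀ k : ℕ, 1 ≤ k → k ≤ 3 → ∀ n : ℕ, 1 ≤ n →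
    ∀ (Γ₀ : Type) [LinearOrderedCommGroupWithZero Γ₀] (v : Valuation ℂ Γ₀), v 7 < 1 →
      v (∑ b : ZMod 7 × ZMod 7, (conj (((quarticCharMod 7 (rep 7 b 0) : GaussianInt) : ℂ))) ^ k *
        (℘[ofUpperHalfPlane UpperHalfPlane.I] (conj ((rep 7 b 0 : GaussianInt) : ℂ) / 7) /
          ((Real.Gamma (1 / 4) ^ 2 / (2 * Real.sqrt (2 * Real.pi)) : ℝ) : ℂ) ^ 2)⁻¹ ^ n) ^ 4 ≤ v 7 ^ (4 - k) := by
  intro k hk1 hk3 n _ Γ₀ _ v h7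
  have hstar : ∀ b : ZMod 7 × ZMod 7, conj ((rep 7 b 0 : GaussianInt) : ℂ) = ((star (rep 7 b 0) : GaussianInt) : ℂ) := fun b ↦
    (GaussianInt.toComplex_star _).symm
  have hchar : ∀ b : ZMod 7 × ZMod 7, conj (((quarticCharMod 7 (rep 7 b 0) : GaussianInt) : ℂ)) =
      ((quarticCharMod 7 (star (rep 7 b 0)) : GaussianInt) : ℂ) := fun b ↦ by
    have h := quarticCharMod_natCast_star (q := 7) (by norm_num) (by norm_num) (rep 7 b 0)
    simp only [Nat.cast_ofNat] at h
    rw [← GaussianInt.toComplex_star, ← h]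
  simp_rw [hchar, hstar]
  refine resolventBound_of_labels hk1 hk3 n (fun b ↦ star (rep 7 b 0)) (fun b ↦ ?_) (fun b b' h ↦ ?_) v h7
  · -- `7 ∣ conj(rep b) ↔ b = 0`
    constructor
    · intro h
      have h' : (7 : GaussianInt) ∣ rep 7 b 0 := by
        obtain ⟨w, hw⟩ := h
        refine ⟨star w, ?_⟩
        rw [← star_star (rep 7 b 0), hw, star_mul', show star (7 : GaussianInt) = 7 by ext <;> simp]
      by_contra hb
      exact not_seven_dvd_rep hb h'
    · rintro rfl
      exact ⟨0, by ext <;> simp [rep]⟩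
  · -- injectivity modulo `7`
    have h' : (7 : GaussianInt) ∣ rep 7 b' 0 - rep 7 b 0 := by
      obtain ⟨w, hw⟩ := h
      refine ⟨-star w, ?_⟩
      have := congrArg star hw
      rw [star_sub, star_star, star_star, star_mul', show star (7 : GaussianInt) = 7 by ext <;> simp] at this
      linear_combination (-1 : GaussianInt) * this
    have := (cls_eq_cls_iff 7 (rep 7 b 0) (rep 7 b' 0)).mpr h'
    rwa [cls_rep, cls_rep] at this

end Resolvent

end Summit.BirchSwinnertonDyer.BirchSwinnertonDyer.Theorems.BiquadraticEisensteinDescentManinDatumSupercuspidalCMInertSevenDivisionResolventBound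

end
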